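import Summits.QuantumFields.YangMills.Theorems.FemtoTransferGapSlabGround
import Summits.QuantumFields.YangMills.Theorems.SwapTwistDeficitPolyakovHolonomy
import Summits.QuantumFields.YangMills.Theorems.FemtoTransferGapAxisPermutation
import HarnessLib

/-!
# The sheet translate `twist k h` with a NON-central element `h`: exact identities

Support module for the covariant-translate cruxes of seat ym-idea-4's LINE g12-A/B (`ToronSmallBall.OffCoreStripWindowDeep` ⟨stmt-QuantumFields-23957⟩,
`ToronCoreRaritySubQuartic` ⟨23956⟩, `QuantileBitPurity.HolonomyLevyWindowDeep` ⟨23949⟩, `HolonomyQuantileSubQuartic` ⟨23948⟩; memos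
HOME `bc/g12-dw/PLAN-SB.md`, `bc/g12-A/PLAN-X1-v2-gauss.md` §0).  The planner's memo §0 records that the translate used by every one of these plans
IS the tree's `FemtoTransferGap.twist k h` — multiply every link in direction `k` issuing from the plane `x_k = 0` by `h` — with a NON-central `h ∈ G`
(for central `h` it is 't Hooft's twist, an exact symmetry: `transferKernel_twist`).  This module proves the `h`-general facts those plans quote:

* §1 (any group, any matrix representation) ★ `timeCoupling_twist_twist` — the time-like coupling is EXACTLY invariant under a simultaneous sheet
  translate of both slices by the same `h` (trace cyclicity: `tr ρ(hUV⁻¹h⁻¹) = tr ρ(UV⁻¹)`), hence the transfer kernel changes only through the two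
  Wilson actions (`transferKernel_twist_twist`);
* §2 the plaquette holonomies under `twist k h`: unchanged off the plane and in planes not containing `k` (`plaquetteHolonomy_twist_of_apply_ne_zero`,
  `plaquetteHolonomy_twist_of_ne_of_ne`), and the two CONJUGATION FORMULAS on the plane (`plaquetteHolonomy_twist_fst`: `h (U₁U₂U₃⁻¹) h⁻¹ U₄⁻¹`;
  `plaquetteHolonomy_twist_snd`: `U₁ h (U₂U₃⁻¹U₄⁻¹) h⁻¹`, whose trace is that of `(h⁻¹U₁h) U₂U₃⁻¹U₄⁻¹`) — the action changes only through the
  commutators of `h` with the transverse links at the plane, exactly the «defects» priced case by case in PLAN-X1 v2 §2;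
* §3 (`SU(2)`) the holonomies through the origin: the `x`-holonomy picks up `h` on the left (tree `polyX_twist_zero`), the `y`- and `z`-holonomies are
  untouched (`polDist_configPerm_swap_twist_zero`);
* §4 measure: a slice-wise sheet translate of the whole chain by slice-dependent but configuration-independent elements preserves the product
  a-priori measure (`measurePreserving_twist_slices`; Fubini-free, from the tree's `measurePreserving_twist`).

HONEST FRAMING: exact fixed-lattice identities (bookkeeping for doors/cruxes of DRAFT lines onto RECORD rungs); no estimate, no semiclassics; nothing
about infinite volume, the continuum limit or the Clay gap.  No `sorry`, no new axiom, no new definition.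
References: [cite: tHooft1979]; [cite: Luscher1983, §2]; [cite: SeilerLNP1982, §3].
-/

set_option autoImplicit false

noncomputable section

open MeasureTheory Filter Topology
open Literature.MathematicalPhysics.QuantumFieldTheory
open Literature.MathematicalPhysics.QuantumLattice
open scoped BigOperators

namespace Summit.QuantumFields.YangMills.Theorems.FemtoTransferGap

/-! ## §1 The time-like coupling and the kernel under a simultaneous sheet translate -/

section General

variable {N : ℕ} {G : Type*} [Group G] (ρ : G →* Matrix (Fin N) (Fin N) ℂ) {L : ℕ}

/-- ★ **The time-like coupling is invariant under a simultaneous sheet translate of both slices by ANY `h`** (not necessarily central):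
`Σₑ Re tr ρ((hUₑ)(hVₑ)⁻¹) = Σₑ Re tr ρ(UₑVₑ⁻¹)` by cyclicity of the trace. [cite: tHooft1979] [cite: SeilerLNP1982, §3] -/
theorem timeCoupling_twist_twist [NeZero L] (k : Fin 3) (h : G) (U V : GaugeConfig 3 L G) :
    timeCoupling ρ (twist k h U) (twist k h V) = timeCoupling ρ U V := by
  have htr : ∀ (a b : G), (ρ (a * b * a⁻¹)).trace = (ρ b).trace := fun a b => by
    rw [map_mul, map_mul, Matrix.trace_mul_cycle, ← map_mul, inv_mul_cancel, map_one, one_mul]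
  unfold timeCoupling
  refine Finset.sum_congr rfl fun e _ => ?_
  have hU : twist k h U e * (twist k h V e)⁻¹ = if e.2 = k ∧ e.1 k = 0 then h * (U e * (V e)⁻¹) * h⁻¹ else U e * (V e)⁻¹ := by
    simp only [twist]
    split_ifs
    · rw [mul_inv_rev]; simp only [mul_assoc]
    · rfl
  rw [hU]
  split_ifs
  · rw [htr]
  · rfl

/-- The transfer kernel under a simultaneous sheet translate: only the two Wilson actions change,
`K_β(twist h U, twist h V) = K_β(U,V) · exp(−(β/2)((S(twist h U) − S(U)) + (S(twist h V) − S(V))))`. [cite: SeilerLNP1982, §3] -/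
theorem transferKernel_twist_twist [NeZero L] (β : ℝ) (k : Fin 3) (h : G) (U V : GaugeConfig 3 L G) :
    transferKernel ρ β (twist k h U) (twist k h V) =
      transferKernel ρ β U V * Real.exp (-(β / 2) * ((wilsonAction ρ (twist k h U) - wilsonAction ρ U) +
        (wilsonAction ρ (twist k h V) - wilsonAction ρ V))) := by
  unfold transferKernel
  rw [timeCoupling_twist_twist, ← Real.exp_add]
  congr 1
  ring

/-! ## §2 Plaquette holonomies under the sheet translate -/

omit ρ in
/-- Off the plane `x_k = 0` nothing changes (genuine plaquette `i ≠ j`). [folklore] -/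
theorem plaquetteHolonomy_twist_of_apply_ne_zero (k : Fin 3) (h : G) (U : GaugeConfig 3 L G) (x : Site 3 L) {i j : Fin 3} (hij : i ≠ j)
    (hx : x k ≠ 0) : plaquetteHolonomy (twist k h U) x i j = plaquetteHolonomy U x i j := by
  have hsh : ∀ (y : Site 3 L) {a b : Fin 3}, b ≠ a → (y.shift a) b = y b := fun y a b hab => by
    simp [Site.shift, Pi.single_eq_of_ne hab]
  have hji : j ≠ i := hij.symm
  unfold plaquetteHolonomy
  by_cases hki : i = k
  · subst hki
    have h3 : (x.shift j) i ≠ 0 := by rw [hsh x hij]; exact hx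
    simp only [twist, hx, h3, hji, and_false, false_and, if_false]
  · by_cases hkj : j = k
    · subst hkj
      have h2 : (x.shift i) j ≠ 0 := by rw [hsh x hji]; exact hx
      simp only [twist, hx, h2, hki, and_false, false_and, if_false]
    · simp only [twist, hki, hkj, false_and, if_false]

omit ρ in
/-- In a plane not containing the direction `k` nothing changes. [folklore] -/
theorem plaquetteHolonomy_twist_of_ne_of_ne (k : Fin 3) (h : G) (U : GaugeConfig 3 L G) (x : Site 3 L) {i j : Fin 3} (hik : i ≠ k)
    (hjk : j ≠ k) : plaquetteHolonomy (twist k h U) x i j = plaquetteHolonomy U x i j := by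
  unfold plaquetteHolonomy
  simp only [twist, hik, hjk, false_and, if_false]

omit ρ in
/-- **Conjugation formula, first direction on the plane**: for `k ≠ j` and `x_k = 0`,
`(twist_k^h U)_{x;k,j} = h · (U(x,k) U(x+e_k,j) U(x+e_j,k)⁻¹) · h⁻¹ · U(x,j)⁻¹` (both `k`-links of the plaquette lie on the plane). [cite: tHooft1979] -/
theorem plaquetteHolonomy_twist_fst (k : Fin 3) (h : G) (U : GaugeConfig 3 L G) (x : Site 3 L) {j : Fin 3} (hkj : k ≠ j) (hx : x k = 0) :
    plaquetteHolonomy (twist k h U) x k j = h * (U (x, k) * U (x.shift k, j) * (U (x.shift j, k))⁻¹) * h⁻¹ * (U (x, j))⁻¹ := by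
  have hsh : (x.shift j) k = 0 := by
    have : (x.shift j) k = x k := by simp [Site.shift, Pi.single_eq_of_ne hkj]
    rw [this, hx]
  have hjk : ¬ (j = k) := fun h' => hkj h'.symm
  unfold plaquetteHolonomy
  simp only [twist, hx, hsh, hjk, and_true, if_true, false_and, if_false, mul_inv_rev]
  simp only [mul_assoc]

omit ρ in
/-- **Conjugation formula, second direction on the plane**: for `i ≠ k` and `x_k = 0`,
`(twist_k^h U)_{x;i,k} = U(x,i) · h · (U(x+e_i,k) U(x+e_k,i)⁻¹ U(x,k)⁻¹) · h⁻¹`. [cite: tHooft1979] -/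
theorem plaquetteHolonomy_twist_snd (k : Fin 3) (h : G) (U : GaugeConfig 3 L G) (x : Site 3 L) {i : Fin 3} (hik : i ≠ k) (hx : x k = 0) :
    plaquetteHolonomy (twist k h U) x i k = U (x, i) * h * (U (x.shift i, k) * (U (x.shift k, i))⁻¹ * (U (x, k))⁻¹) * h⁻¹ := by
  have hsh : (x.shift i) k = 0 := by
    have : (x.shift i) k = x k := by simp [Site.shift, Pi.single_eq_of_ne (Ne.symm hik)]
    rw [this, hx]
  unfold plaquetteHolonomy
  simp only [twist, hx, hsh, hik, and_true, if_true, false_and, if_false, mul_inv_rev]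
  simp only [mul_assoc]

/-- The trace of the second conjugation formula: `tr ρ((twist_k^h U)_{x;i,k}) = tr ρ((h⁻¹ U(x,i) h) · U(x+e_i,k) U(x+e_k,i)⁻¹ U(x,k)⁻¹)` — only the first link
is conjugated by `h`. [folklore] -/
theorem trace_plaquetteHolonomy_twist_snd (k : Fin 3) (h : G) (U : GaugeConfig 3 L G) (x : Site 3 L) {i : Fin 3} (hik : i ≠ k) (hx : x k = 0) :
    (ρ (plaquetteHolonomy (twist k h U) x i k)).trace =
      (ρ (h⁻¹ * U (x, i) * h * (U (x.shift i, k) * (U (x.shift k, i))⁻¹ * (U (x, k))⁻¹))).trace := by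
  rw [plaquetteHolonomy_twist_snd k h U x hik hx]
  have e1 : U (x, i) * h * (U (x.shift i, k) * (U (x.shift k, i))⁻¹ * (U (x, k))⁻¹) * h⁻¹ =
      h * (h⁻¹ * U (x, i) * h * (U (x.shift i, k) * (U (x.shift k, i))⁻¹ * (U (x, k))⁻¹)) * h⁻¹ := by
    simp only [← mul_assoc, mul_inv_cancel, one_mul]
  rw [e1, map_mul, map_mul, Matrix.trace_mul_cycle, ← map_mul, inv_mul_cancel, map_one, one_mul]

/-- The trace of the first conjugation formula: `tr ρ((twist_k^h U)_{x;k,j}) = tr ρ(U(x,k) U(x+e_k,j) U(x+e_j,k)⁻¹ · (h⁻¹ U(x,j)⁻¹ h))` — only the last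
link is conjugated by `h`. [folklore] -/
theorem trace_plaquetteHolonomy_twist_fst (k : Fin 3) (h : G) (U : GaugeConfig 3 L G) (x : Site 3 L) {j : Fin 3} (hkj : k ≠ j) (hx : x k = 0) :
    (ρ (plaquetteHolonomy (twist k h U) x k j)).trace =
      (ρ (U (x, k) * U (x.shift k, j) * (U (x.shift j, k))⁻¹ * (h⁻¹ * (U (x, j))⁻¹ * h))).trace := by
  rw [plaquetteHolonomy_twist_fst k h U x hkj hx]
  have e1 : h * (U (x, k) * U (x.shift k, j) * (U (x.shift j, k))⁻¹) * h⁻¹ * (U (x, j))⁻¹ =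
      h * (U (x, k) * U (x.shift k, j) * (U (x.shift j, k))⁻¹ * (h⁻¹ * (U (x, j))⁻¹ * h)) * h⁻¹ := by
    simp only [← mul_assoc]; rw [mul_assoc _ h h⁻¹, mul_inv_cancel, mul_one]
  rw [e1, map_mul, map_mul, Matrix.trace_mul_cycle, ← map_mul, inv_mul_cancel, map_one, one_mul]

end General

/-! ## §3 `SU(2)`: the holonomies through the origin under the `x`-sheet translate -/

section Holonomy

variable {L : ℕ}

/-- The `y`- and `z`-Polyakov holonomies through the origin do not see the `x`-sheet translate: for the axis swap `σ = (0 1)` or `(0 2)`,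
`polDist (configPerm σ (twist 0 h U)) = polDist (configPerm σ U)` (`configPerm_twist`, `polyX_twist_of_ne`). [cite: Luscher1983, §2] -/
theorem polDist_configPerm_swap_twist_zero {j : Fin 3} (hj : j ≠ 0) (h : SU2) (U : GaugeConfig 3 L SU2) :
    FlatSheet.polDist (configPerm (Equiv.swap (0 : Fin 3) j) (twist 0 h U)) = FlatSheet.polDist (configPerm (Equiv.swap (0 : Fin 3) j) U) := by
  rw [configPerm_twist, Equiv.swap_apply_left]
  unfold FlatSheet.polDist
  rw [FlatSheet.polyX_twist_of_ne hj]

/-- The `x`-holonomy picks up `h` on the left: `polyX (twist 0 h U) = h · polyX U` (tree `polyX_twist_zero`), so its distance to the centre is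
`vacDist (h · polyX U)`. [cite: Luscher1983, §2] -/
theorem polDist_twist_zero [NeZero L] (h : SU2) (U : GaugeConfig 3 L SU2) :
    FlatSheet.polDist (twist 0 h U) = vacDist (h * FlatSheet.polyX U) := by
  unfold FlatSheet.polDist
  rw [FlatSheet.polyX_twist_zero]

end Holonomy

/-! ## §4 Slice-wise sheet translates of a chain preserve the product a-priori measure -/

section Chain

variable {G : Type*} [Group G] [MeasurableSpace G] [TopologicalSpace G] [IsTopologicalGroup G] [BorelSpace G] [CompactSpace G]
  {L : ℕ} [NeZero L]

/-- **Slice-wise sheet translates preserve the chain's a-priori measure**: for slice-dependent but configuration-independent elements `h t`, the map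
`U⃗ ↦ (twist k (h t) U_t)_t` preserves `⊗_t configMeasure` (each slice map is a product of left translations and identities: `measurePreserving_twist`).
[folklore] -/
theorem measurePreserving_twist_slices {n : ℕ} (k : Fin 3) (h : Fin n → G) :
    MeasurePreserving (fun (Us : Fin n → GaugeConfig 3 L G) (t : Fin n) => twist k (h t) (Us t))
      (Measure.pi fun _ : Fin n => configMeasure G L) (Measure.pi fun _ : Fin n => configMeasure G L) :=
  measurePreserving_pi (fun _ : Fin n => configMeasure G L) (fun _ : Fin n => configMeasure G L) fun t => measurePreserving_twist k (h t)

end Chain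

end Summit.QuantumFields.YangMills.Theorems.FemtoTransferGap

end
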